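import Summits.CriticalPhenomena.PercolationContinuityZ3.Theorems.Transplant.SiteKNRun
import Literature.Probability.Percolation.KozmaNitzanTheorem6
import HarnessLib

/-!
# SITE Kozma–Nitzan §4 — (32), validity of the probed histories, and lawfulness of the site scheme on the star carrier

builds on p205010 (kernel theorem, internal audit signed; external expert review pending).
Lane `prim-bschramm`, class C1a (site percolation on `ℤ³`); block (γ) of the SITE same-`p` witness
(`SiteSameP.SiteSamePWitnessZd`, socket p217536), prim-hp-8 lineage.  Site twin of `KSch.reach_of_probe` … `KSch.lawful`
of `L/KozmaNitzanTheorem6.lean`.  Helper file (`--supports stmt-CriticalPhenomena-4575`).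

* `reach_of_probe`, `reach_zero` — (32) for `w ≠ 0` (from the goodness of the connection at level `j_x`) and for `w = 0`
  (from the hypothesis `hQ0` on the pinned-open cube `Q_0`);
* `valid_of_choice` — every history of the run at which an edge is chosen is valid; **`lawful`** — the site scheme is
  lawful on the star carrier `⊤` given `hQ0` and the failure bound (33) after valid histories, transported from
  `P^{site}_p` to `P^{⊤}_p ∘ starRead⁻¹` (`SiteStar.bondPercolation_real_preimage_starRead`).
[cite: KozmaNitzan2024, §4 pp. 25–31 ((32), Definition of an exploration process)]
-/

noncomputable section

namespace Summit.CriticalPhenomena.PercolationContinuityZ3.Theorems.Transplant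

namespace SiteKN

open MeasureTheory ProbabilityTheory
open Literature.Probability.Percolation Literature.Probability.LatticeModels
open Literature.Probability.Percolation.KozmaNitzan Literature.Probability.Percolation.KozmaNitzan.Cells
open GadgetSystem ProbeHistory Contour HSiteScheme
open SiteTransplant (siteConn mem_siteConn)
open SiteStar (starEdge starRead starEdge_injective mem_starRead top_adj_none_some)
open scoped Classical

variable {d : ℕ}

namespace SKSch

section Consequences

variable {S : SKSch d} {ω : BondConfig (Option (Site d))}

/-! ## (32) -/

/-- The recorded pattern is `starRead ω ∪ Q_0` on the explored vertices: the two pinnings agree. [folklore] -/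
theorem pinW_V_ξ_eq (n : ℕ) :
    pinW (fun _ : Site d => S.p) ↑(S.V (S.hst ω n)) ↑(S.ξ (S.hst ω n)) =
      pinW (fun _ : Site d => S.p) ↑(S.V (S.hst ω n)) (starRead ω ∪ ↑S.U₀V) := by
  refine pinW_congr _ fun x hx => ?_
  rw [Finset.mem_coe, (S.runInv ω n).ξ_iff x, Set.mem_union, Finset.mem_coe]
  exact ⟨fun h => h.2, fun h => ⟨Finset.mem_coe.1 hx, h⟩⟩

/-- `P[W₀](0 ↔ M_v) = P[pinned on starRead ω ∪ Q_0](0 ↔ M_v in E_i ∪ E_{w,v})`. [cite: KozmaNitzan2024, §4 p. 28 ((32))] -/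
theorem real_W₀_eq (n : ℕ) (e : Site 2 × MDir) :
    (prodBernoulli (S.W₀ (S.hst ω n) e)).real (⋃ t ∈ S.C.M (tgt e), siteConn (zdGraph d) (0 : Site d) t) =
      (prodBernoulli (pinW (fun _ : Site d => S.p) ↑(S.V (S.hst ω n)) (starRead ω ∪ ↑S.U₀V))).real
        (⋃ t ∈ (↑(S.C.M (tgt e)) : Set (Site d)),
          siteConnIn (zdGraph d) (↑(S.V (S.hst ω n) ∪ S.C.Ewv e.1 e.2) : Set (Site d)) 0 t) := by
  rw [W₀, ← Finset.set_biUnion_coe, prodBernoulli_siteRestrW_real_biUnion_siteConn (zdGraph d), pinW_V_ξ_eq]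

/-- **(32) for `w ≠ 0`** (KN p. 28 and Step I): if `w` was examined at time `m < n` and its connection to the still
undetermined `v = w + du` was good at level `j_x`, then `P(0 ↔ M_v in E_n ∪ E_{w,v} | sites of E_n) > 1 − δ`.
[cite: KozmaNitzan2024, §4 p. 28 ((32) for w ≠ 0)] -/
theorem reach_of_probe {n m : ℕ} (hm : m < n) {e : Site 2 × MDir}
    (hc : (S.scheme.stN m ω).choice = some e) (hV : S.Valid (S.hst ω m) e)
    (hD : S.scheme.E.next (S.hst ω m) = some (S.probe (S.hst ω m) e)) {du : MDir}
    (hv : ¬(S.scheme.stN n ω).Det (tgt e + stepVec du))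
    (hcond : S.cond (S.hst ω m) e du
      (S.jOf (S.hst ω m) e du (obsV (starRead ω) (S.envV (S.hst ω m) e))) (obsV (starRead ω) (S.envV (S.hst ω m) e))) :
    1 - S.δc < (prodBernoulli (S.W₀ (S.hst ω n) (tgt e, du))).real
      (⋃ t ∈ S.C.M (tgt (tgt e, du)), siteConn (zdGraph d) (0 : Site d) t) := by
  set hm_ := S.hst ω m with hhm
  set o := obsV (starRead ω) (S.envV hm_ e) with ho
  set j := S.jOf hm_ e du o with hjdef
  have hI := S.runInv ω n
  have hIm := S.runInv ω m
  have hdu : du ∈ S.onward hm_ (tgt e) := mem_onward_of_not_det hm.le hv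
  have hjK : j < S.C.K := S.jOf_lt _ _ _ _
  -- `Rj_m ⊆ V_n`
  have hRjV : S.Rj hm_ e du j ⊆ S.V (S.hst ω n) := by
    intro x hx
    by_cases hxV : x ∈ S.V hm_
    · exact S.V_mono_run ω hm.le hxV
    · have h1 : x ∈ S.revealV hm_ e o := S.Rj_sdiff_subset_revealV hdu le_rfl (Finset.mem_sdiff.2 ⟨hx, hxV⟩)
      exact newRegion_subset_V hm hc hD (Finset.mem_sdiff.1 h1).1
  -- `V_n ∩ Sx_m ⊆ Rj_m` ((31))
  have hkey : ∀ x ∈ S.V (S.hst ω n), x ∈ S.Sx hm_ e du → x ∈ S.Rj hm_ e du j := by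
    intro x hxV hxS
    rcases Finset.mem_union.1 hxS with hxS | hxS
    · exact Finset.mem_union_left _ hxS
    · exact Finset.mem_union_right _ (mem_Stub_of_mem_V_of_mem_Efar hm hc hV hD hv hxV hxS)
  -- the weights agree on `Sx_m`
  have hpq : ∀ x ∈ (↑(S.Sx hm_ e du) : Set (Site d)),
      pinW (fun _ : Site d => S.p) ↑(S.Rj hm_ e du j) ↑(S.pat hm_ e du j o) x =
        pinW (fun _ : Site d => S.p) ↑(S.V (S.hst ω n)) (starRead ω ∪ ↑S.U₀V) x := by
    intro x hxS
    by_cases hxj : x ∈ S.Rj hm_ e du j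
    · refine KSch.pinW_apply_eq_of_mem _ (Finset.mem_coe.2 hxj) (Finset.mem_coe.2 (hRjV hxj)) ?_
      rw [Finset.mem_coe, pat, Finset.mem_union, Finset.mem_inter, Finset.mem_sdiff, ho, mem_obsV_iff, Set.mem_union,
        Finset.mem_coe, mem_starRead]
      by_cases hxV : x ∈ S.V hm_
      · rw [hIm.ξ_iff x, mem_starRead]
        constructor
        · rintro (⟨-, h'⟩ | ⟨-, -, h'⟩)
          · exact h'
          · exact absurd hxV h'
        · intro h'; exact Or.inl ⟨hxV, h'⟩
      · have hxenv : x ∈ S.envV hm_ e := S.Rj_sdiff_subset_envV hm_ e hdu hjK (Finset.mem_sdiff.2 ⟨hxj, hxV⟩)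
        have hxU : x ∉ S.U₀V := fun h' => hxV (S.U₀V_subset_V _ h')
        constructor
        · rintro (h' | ⟨⟨-, h'⟩, -, -⟩)
          · exact absurd (hV.ξ_sub h') hxV
          · exact Or.inl h'
        · rintro (h' | h')
          · exact Or.inr ⟨⟨hxenv, h'⟩, hxj, hxV⟩
          · exact absurd h' hxU
    · have hxF : x ∉ S.V (S.hst ω n) := fun h' => hxj (hkey x h' (Finset.mem_coe.1 hxS))
      rw [pinW_apply_of_not_mem _ _ (fun h' => hxj (Finset.mem_coe.1 h')),
        pinW_apply_of_not_mem _ _ (fun h' => hxF (Finset.mem_coe.1 h'))]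
  -- `Sx_m ⊆ E_n ∪ E_{w,v}`
  have hSx : (↑(S.Sx hm_ e du) : Set (Site d)) ⊆ ↑(S.V (S.hst ω n) ∪ S.C.Ewv (tgt e) du) := by
    refine Finset.coe_subset.2 fun y hy => ?_
    rcases Finset.mem_union.1 hy with hy | hy
    · rcases Finset.mem_union.1 hy with hy | hy
      · exact Finset.mem_union_left _ (S.V_mono_run ω hm.le hy)
      · exact Finset.mem_union_left _ (newRegion_subset_V hm hc hD (Finset.mem_union_left _ hy))
    · exact Finset.mem_union_right _ (S.C.Efar_subset_Ewv _ _ hy)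
  -- the chain
  have e1 : (prodBernoulli (S.Wt hm_ e du j o)).real (S.Conn e du) =
      (prodBernoulli (pinW (fun _ : Site d => S.p) ↑(S.Rj hm_ e du j) ↑(S.pat hm_ e du j o))).real
        (⋃ t ∈ (↑(S.C.M (tgt e + stepVec du)) : Set (Site d)),
          siteConnIn (zdGraph d) (↑(S.Sx hm_ e du) : Set (Site d)) 0 t) := by
    rw [Conn, Wt, ← Finset.set_biUnion_coe, prodBernoulli_siteRestrW_real_biUnion_siteConn (zdGraph d)]
  have e2 : (prodBernoulli (pinW (fun _ : Site d => S.p) ↑(S.Rj hm_ e du j) ↑(S.pat hm_ e du j o))).real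
        (⋃ t ∈ (↑(S.C.M (tgt e + stepVec du)) : Set (Site d)),
          siteConnIn (zdGraph d) (↑(S.Sx hm_ e du) : Set (Site d)) 0 t) =
      (prodBernoulli (pinW (fun _ : Site d => S.p) ↑(S.V (S.hst ω n)) (starRead ω ∪ ↑S.U₀V))).real
        (⋃ t ∈ (↑(S.C.M (tgt e + stepVec du)) : Set (Site d)),
          siteConnIn (zdGraph d) (↑(S.Sx hm_ e du) : Set (Site d)) 0 t) :=
    prodBernoulli_real_eq_of_determinedBy _ _ hpq (determinedBy_biUnion_siteConnIn _ _ _ _)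
      (measurableSet_biUnion_siteConnIn _ _ _ _)
  have e3 : (prodBernoulli (pinW (fun _ : Site d => S.p) ↑(S.V (S.hst ω n)) (starRead ω ∪ ↑S.U₀V))).real
        (⋃ t ∈ (↑(S.C.M (tgt e + stepVec du)) : Set (Site d)),
          siteConnIn (zdGraph d) (↑(S.Sx hm_ e du) : Set (Site d)) 0 t) ≤
      (prodBernoulli (pinW (fun _ : Site d => S.p) ↑(S.V (S.hst ω n)) (starRead ω ∪ ↑S.U₀V))).real
        (⋃ t ∈ (↑(S.C.M (tgt e + stepVec du)) : Set (Site d)),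
          siteConnIn (zdGraph d) (↑(S.V (S.hst ω n) ∪ S.C.Ewv (tgt e) du) : Set (Site d)) 0 t) :=
    measureReal_mono (biUnion_siteConnIn_mono (zdGraph d) hSx 0 subset_rfl) (measure_ne_top _ _)
  have hc' : 1 - S.δc < (prodBernoulli (S.Wt hm_ e du j o)).real (S.Conn e du) := hcond
  rw [real_W₀_eq]
  change 1 - S.δc < (prodBernoulli (pinW (fun _ : Site d => S.p) ↑(S.V (S.hst ω n)) (starRead ω ∪ ↑S.U₀V))).real
    (⋃ t ∈ (↑(S.C.M (tgt e + stepVec du)) : Set (Site d)),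
      siteConnIn (zdGraph d) (↑(S.V (S.hst ω n) ∪ S.C.Ewv (tgt e) du) : Set (Site d)) 0 t)
  rw [e1, e2] at hc'
  exact lt_of_lt_of_le hc' e3

/-- **(32) for `w = 0`** (KN p. 28): the cube `Q_0` is pinned open, and by the choice of `r` (hypothesis `hQ0`) `0` is joined
to `M_v` inside `Q_0 ∪ E_{0,v}` with probability `> 1 − δ`. [cite: KozmaNitzan2024, §4 p. 28 ((32) for w = 0)] -/
theorem reach_zero {n : ℕ} {du : MDir} (hv : ¬(S.scheme.stN n ω).Det ((0 : Site 2) + stepVec du))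
    (hQ0 : 1 - S.δc < (prodBernoulli (pinW (fun _ : Site d => S.p) ↑S.U₀V ↑S.U₀V)).real
      (⋃ t ∈ (↑(S.C.M ((0 : Site 2) + stepVec du)) : Set (Site d)),
        siteConnIn (zdGraph d) (↑(S.C.Q 0 ∪ S.C.Ewv 0 du) : Set (Site d)) 0 t)) :
    1 - S.δc < (prodBernoulli (S.W₀ (S.hst ω n) ((0 : Site 2), du))).real
      (⋃ t ∈ S.C.M (tgt ((0 : Site 2), du)), siteConn (zdGraph d) (0 : Site d) t) := by
  have hQ0V : S.C.Q 0 ⊆ S.V (S.hst ω n) := S.U₀V_subset_V _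
  have hpq : ∀ x ∈ (↑(S.C.Q 0 ∪ S.C.Ewv 0 du) : Set (Site d)),
      pinW (fun _ : Site d => S.p) ↑S.U₀V ↑S.U₀V x =
        pinW (fun _ : Site d => S.p) ↑(S.V (S.hst ω n)) (starRead ω ∪ ↑S.U₀V) x := by
    intro x hxS
    rcases Finset.mem_union.1 (Finset.mem_coe.1 hxS) with hxQ | hxE
    · have hxU : x ∈ S.U₀V := hxQ
      refine KSch.pinW_apply_eq_of_mem _ (Finset.mem_coe.2 hxU) (Finset.mem_coe.2 (hQ0V hxQ)) ?_
      simp only [Finset.mem_coe, Set.mem_union, hxU, or_true]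
    · have hxV : x ∉ S.V (S.hst ω n) := fun h' => hv (det_of_mem_V_of_mem_Ewv_zero h' hxE)
      have hxU : x ∉ S.U₀V := fun h' => hxV (S.U₀V_subset_V _ h')
      rw [pinW_apply_of_not_mem _ _ (fun h' => hxU (Finset.mem_coe.1 h')),
        pinW_apply_of_not_mem _ _ (fun h' => hxV (Finset.mem_coe.1 h'))]
  have hsub : (↑(S.C.Q 0 ∪ S.C.Ewv 0 du) : Set (Site d)) ⊆ ↑(S.V (S.hst ω n) ∪ S.C.Ewv 0 du) :=
    Finset.coe_subset.2 (Finset.union_subset_union hQ0V le_rfl)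
  have e2 : (prodBernoulli (pinW (fun _ : Site d => S.p) ↑S.U₀V ↑S.U₀V)).real
        (⋃ t ∈ (↑(S.C.M ((0 : Site 2) + stepVec du)) : Set (Site d)),
          siteConnIn (zdGraph d) (↑(S.C.Q 0 ∪ S.C.Ewv 0 du) : Set (Site d)) 0 t) =
      (prodBernoulli (pinW (fun _ : Site d => S.p) ↑(S.V (S.hst ω n)) (starRead ω ∪ ↑S.U₀V))).real
        (⋃ t ∈ (↑(S.C.M ((0 : Site 2) + stepVec du)) : Set (Site d)),
          siteConnIn (zdGraph d) (↑(S.C.Q 0 ∪ S.C.Ewv 0 du) : Set (Site d)) 0 t) :=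
    prodBernoulli_real_eq_of_determinedBy _ _ hpq (determinedBy_biUnion_siteConnIn _ _ _ _)
      (measurableSet_biUnion_siteConnIn _ _ _ _)
  have e3 : (prodBernoulli (pinW (fun _ : Site d => S.p) ↑(S.V (S.hst ω n)) (starRead ω ∪ ↑S.U₀V))).real
        (⋃ t ∈ (↑(S.C.M ((0 : Site 2) + stepVec du)) : Set (Site d)),
          siteConnIn (zdGraph d) (↑(S.C.Q 0 ∪ S.C.Ewv 0 du) : Set (Site d)) 0 t) ≤
      (prodBernoulli (pinW (fun _ : Site d => S.p) ↑(S.V (S.hst ω n)) (starRead ω ∪ ↑S.U₀V))).real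
        (⋃ t ∈ (↑(S.C.M ((0 : Site 2) + stepVec du)) : Set (Site d)),
          siteConnIn (zdGraph d) (↑(S.V (S.hst ω n) ∪ S.C.Ewv 0 du) : Set (Site d)) 0 t) :=
    measureReal_mono (biUnion_siteConnIn_mono (zdGraph d) hsub 0 subset_rfl) (measure_ne_top _ _)
  rw [real_W₀_eq]
  rw [e2] at hQ0
  exact lt_of_lt_of_le hQ0 e3

/-- **Every history of the run at which an edge is chosen is valid, hence probed** ((29), the cover property and (32)).
[cite: KozmaNitzan2024, §4 pp. 26–28 ((29), (31), (32))] -/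
theorem valid_of_choice
    (hQ0 : ∀ du : MDir, 1 - S.δc < (prodBernoulli (pinW (fun _ : Site d => S.p) ↑S.U₀V ↑S.U₀V)).real
      (⋃ t ∈ (↑(S.C.M ((0 : Site 2) + stepVec du)) : Set (Site d)),
        siteConnIn (zdGraph d) (↑(S.C.Q 0 ∪ S.C.Ewv 0 du) : Set (Site d)) 0 t))
    {n : ℕ} {e : Site 2 × MDir} (hc : (S.scheme.stN n ω).choice = some e) :
    S.nextProbe (S.hst ω n) = some (S.probe (S.hst ω n) e) := by
  have hI := S.runInv ω n
  obtain ⟨he1, he2⟩ := HState.cand_of_choice hc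
  refine S.nextProbe_of_valid hc ⟨fun x hx => ((hI.ξ_iff x).1 hx).1, (zero_mem_run n).1,
    Q_subset_V_of_det (Or.inl he1) (center_mem_cIcc _ _), ?_, ?_⟩
  · refine ⟨{x | (S.scheme.stN n ω).Det x}, he2, fun du hdu hdet => ?_, V_subset_Cover n⟩
    exact (Finset.mem_filter.1 hdu).2 (Q_subset_V_of_det hdet (center_mem_cIcc _ _))
  · obtain ⟨w, du⟩ := e
    rcases S.scheme.exists_probe_of_det ω n w (Or.inl he1) with hw0 | ⟨m, hm, e₀, P, hc₀, ht₀, hP, hocc⟩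
    · subst hw0
      exact reach_zero he2 (hQ0 du)
    · obtain ⟨e₁, hc₁, hV₀, rfl⟩ := S.of_next_some hP
      rw [hc₀] at hc₁
      cases Option.some_injective _ hc₁
      subst ht₀
      have hsucc : S.succV (S.hst ω m) e₀ (obsV (starRead ω) (S.envV (S.hst ω m) e₀)) :=
        (S.succ_read_iff _ _ _).1 (hocc.1 he1)
      have hdu : du ∈ S.onward (S.hst ω m) (tgt e₀) := mem_onward_of_not_det hm.le he2
      exact reach_of_probe hm hc₀ hV₀ hP he2 (hsucc du hdu)

/-- **The failure event on the star carrier is the preimage of the site failure event under `starRead`.** [folklore] -/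
theorem setOf_not_succ_eq (h : ProbeHistory (Option (Site d))) (e : Site 2 × MDir) :
    {ω : BondConfig (Option (Site d)) | ¬S.succ h e ((S.probe h e).read ω)} = starRead ⁻¹' S.fail h e := by
  ext ω
  simp only [Set.mem_setOf_eq, Set.mem_preimage, fail, S.succ_read_iff]

/-- **The site exploration process is lawful on the star carrier `⊤`**, given (32) at the origin (`hQ0`) and the failure
bound (33) after valid histories under `P^{site}_p` (`hfail`). [cite: KozmaNitzan2024, §4 pp. 25–31] -/
theorem lawful {ε : ℝ}
    (hQ0 : ∀ du : MDir, 1 - S.δc < (prodBernoulli (pinW (fun _ : Site d => S.p) ↑S.U₀V ↑S.U₀V)).real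
      (⋃ t ∈ (↑(S.C.M ((0 : Site 2) + stepVec du)) : Set (Site d)),
        siteConnIn (zdGraph d) (↑(S.C.Q 0 ∪ S.C.Ewv 0 du) : Set (Site d)) 0 t))
    (hfail : ∀ h e, S.Valid h e → (sitePercolation (Site d) S.p).real (S.fail h e) ≤ ε) :
    S.scheme.Lawful (⊤ : SimpleGraph (Option (Site d))) S.p ε where
  fresh := by
    intro h P hP
    obtain ⟨e, -, -, rfl⟩ := S.nextProbe_eq_some hP
    constructor
    · rw [Set.disjoint_left]
      intro x hx hxU
      obtain ⟨v, hv, rfl⟩ := mem_stars_iff.1 (Finset.mem_coe.1 hx)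
      have hvU : v ∈ S.U₀V := starEdge_mem_stars.1 (Finset.mem_coe.1 hxU)
      exact (Finset.mem_sdiff.1 hv).2 (S.U₀V_subset_V _ hvU)
    · rw [Finset.disjoint_left]
      intro x hx hxs
      obtain ⟨v, hv, rfl⟩ := mem_stars_iff.1 hx
      exact (Finset.mem_sdiff.1 hv).2 (Finset.mem_union_right _ (mem_unstar.2 hxs))
  probes := by
    intro ω _ n hc
    obtain ⟨e, he⟩ := Option.ne_none_iff_exists'.1 hc
    show S.nextProbe (S.hst ω n) ≠ none
    rw [valid_of_choice hQ0 he]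
    exact Option.some_ne_none _
  fail := by
    intro h P e hP hc
    obtain ⟨e', hc', hV, rfl⟩ := S.nextProbe_eq_some hP
    have hcc : some e' = some e := hc'.symm.trans hc
    cases Option.some_injective _ hcc
    change (bondPercolation ⊤ S.p).real {ω | ¬S.succ h e ((S.probe h e).read ω)} ≤ ε
    rw [setOf_not_succ_eq,
      SiteStar.bondPercolation_real_preimage_starRead ⊤ top_adj_none_some S.p (measurableSet_fail S h e)]
    exact hfail h _ hV

end Consequences

end SKSch

end SiteKN

end Summit.CriticalPhenomena.PercolationContinuityZ3.Theorems.Transplant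

end
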